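import Summits.QuantumFields.YangMills.Theorems.BalabanUVNodesN19SingleModeTwoSided
import Summits.QuantumFields.YangMills.Theorems.BalabanUVNodesN19OscillatingLinksMultiscale

/-!
# YM-DAG node N19 (= NE7 proper) — BAND-LIMITED TRIGONOMETRIC LINKS OF THE ℓ¹-NORM, LOG-FREE
# (`Σ_n(a_n cos ω_nS + b_n sin ω_nS)` within `80·(Σ_n(|a_n| + |b_n|)ω_n)·d∕t` at total degree `t` when `max_n ω_n·d·log₂²t ≤ t∕2048`)

Cell `pub-ymgap`, HUMAN RULING D-0062 (Track A) ∕ D-0149 (work-bound push), R141 (C) wider-strategy seat `pub-ymgap-dag-n19-e` (strategy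
s3 = ALTERNATIVE CURRENCY), generation g32, module 11 (lineage module 149).  Route `Summits/QuantumFields/YangMills/Theses/BalabanUVNodes.lean`,
cluster item K3⁸ «SpineGivenEndpointR13SepCoPHV» (stmt-QuantumFields-27366); filed `--supports` that item `--as helper` (it proves no registered
stub).  COUNT-NEUTRAL: [folklore]∕[bookkeeping] over the lineage BY NAME — module 140 `…N19SingleModeLogFree` (`exists_mvPolynomial_near_{cos,sin}_l1Norm_logFree`),
module 120 `…N19OscillatingLinksMultiscale` (`l1Norm_mem_Icc`; the linear-combination pattern), module 125 `…N19OscillatingLinksMomentDiscrepancy`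
(`abs_integral_sub_integral_le_of_near`, `continuous_l1Norm`); no scheme object, no Theses import; NOT a discharge claim.

CONTENT.  Module 120 priced trigonometric links `c + Σ_{n<N}(a_n cos(ω_nS) + b_n sin(ω_nS))` of `S = Σ_{i≤d}|x_i|` mode by mode with the multiscale
faces: `Σ_n(|a_n| + |b_n|)(J + 1 + 4ω_n d)∕2^J` at degree `(J+1)(2^{J+2} + 150Ωd)` — `≲ W·log²t∕t`.  With module 140's LOG-FREE faces, for BAND-LIMITED
links (`ω_n ≤ Ω`, `Ωd·log₂²t ≤ t∕2048`, `t ≥ 512`):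
§1 ★★ `exists_mvPolynomial_near_trigSum_l1Norm_logFree` — `P` of total degree `≤ t` with `|c + Σ_n(…) − P(x)| ≤ Σ_n(|a_n| + |b_n|)·80ω_n d∕t` on the cube
(the constant term is free; each mode at its own frequency) · ★ `exists_mvPolynomial_near_link_of_trigApprox_logFree` (`h(S)` within `τ` of such a sum
on `[0, d]`: `+τ`) · §2 ★ `abs_integral_trigLink_l1Norm_sub_le_logFree` (laws agreeing on `Π_t`: `≤ 2(τ + Σ_n(|a_n| + |b_n|)·80ω_n d∕t)`, module 125's
transfer).
READING (CURRENCY-MAP v11, honest): band-limited Wiener-type links `h` with `W′ := Σ_n(|a_n| + |b_n|)ω_n < ∞` and spectrum `≤ Ω` cost `≤ 80·W′·d∕t` —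
the ridge rate with NO logarithm and NO dependence on the number of modes, uniformly in `d`, for `Ωd ≲ t∕log²t`.  NOT band-limited links (zigzags,
hinges, C² links: spectrum up to `≍ t∕d`) keep one `log t` from the harmonic sum over frequencies plus the frequencies beyond the log-free regime — not
re-run here (OPEN list).  Nothing of Bałaban's; NE7 NOT PRINTED, NOT proved; N19 NOT discharged; count-neutral.

HONEST FRAMING (binding).  Elementary and [folklore]; ONE-SIDED (upper bounds); NO consumer in the DAG today (the seat's own currency map, degree
model and its `W₁` face); nothing of Bałaban's instantiated.  One finite `T⁴` programme at fixed `ε`; nothing continuum ∕ `ℝ⁴` ∕ OS ∕ mass-gap ∕ Clay.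
0 `def` ∕ 0 `sorry`.
-/

noncomputable section

open Finset MeasureTheory
open scoped Real

namespace Summit.QuantumFields.YangMills.Theorems.BalabanUVNodesN19OscillatingLinksLogFree

open Summit.QuantumFields.YangMills.Theorems.BalabanUVNodesN19SingleModeLogFree
  (exists_mvPolynomial_near_cos_l1Norm_logFree exists_mvPolynomial_near_sin_l1Norm_logFree)
open Summit.QuantumFields.YangMills.Theorems.BalabanUVNodesN19OscillatingLinksMultiscale (l1Norm_mem_Icc)
open Summit.QuantumFields.YangMills.Theorems.BalabanUVNodesN19OscillatingLinksMomentDiscrepancy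
  (abs_integral_sub_integral_le_of_near continuous_l1Norm)

variable {ι : Type*} [Fintype ι]

/-! ## §1 ★★ Band-limited trigonometric links, log-free [folklore] -/

/-- ★★ **BAND-LIMITED TRIGONOMETRIC LINKS OF THE ℓ¹-NORM, LOG-FREE.**  For `t ≥ 512`, frequencies `0 ≤ ω_n ≤ Ω` (`n < N`) with `Ωd·(log₂t)² ≤ t∕2048`
(`d = |ι|`) and coefficients `c, a_n, b_n` there is `P : MvPolynomial ι ℝ` of total degree `≤ t` with
`|c + Σ_{n<N}(a_n cos(ω_nS(x)) + b_n sin(ω_nS(x))) − P(x)| ≤ Σ_{n<N}(|a_n| + |b_n|)·80ω_n d∕t` on `[−1,1]^ι` (`S(x) = Σ_i|x_i|`): module 140's log-free cos ∕ sin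
faces mode by mode (each mode is in the regime since `ω_n ≤ Ω`), summed — degrees do not grow under addition. [folklore] -/
theorem exists_mvPolynomial_near_trigSum_l1Norm_logFree (c : ℝ) (a b ω : ℕ → ℝ) (N : ℕ) {Ω : ℝ}
    (hω0 : ∀ n, 0 ≤ ω n) (hωΩ : ∀ n, n < N → ω n ≤ Ω) {t : ℕ} (ht : 512 ≤ t)
    (hreg : Ω * Fintype.card ι * Real.logb 2 t ^ 2 ≤ t / 2048) :
    ∃ P : MvPolynomial ι ℝ, P.totalDegree ≤ t ∧
      ∀ x : ι → ℝ, (∀ i, x i ∈ Set.Icc (-1 : ℝ) 1) →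
        |(c + ∑ n ∈ range N, (a n * Real.cos (ω n * ∑ i, |x i|) + b n * Real.sin (ω n * ∑ i, |x i|))) -
            MvPolynomial.eval x P| ≤
          ∑ n ∈ range N, (|a n| + |b n|) * (80 * (ω n * Fintype.card ι) / t) := by
  classical
  set d : ℝ := (Fintype.card ι : ℝ) with hd
  have hd0 : 0 ≤ d := Nat.cast_nonneg _
  have hL0 : 0 ≤ Real.logb 2 t ^ 2 := sq_nonneg _
  -- every mode below `Ω` is in the log-free regime
  have hregn : ∀ n, n < N → ω n * Fintype.card ι * Real.logb 2 t ^ 2 ≤ t / 2048 := by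
    intro n hn
    have h1 : ω n * d * Real.logb 2 t ^ 2 ≤ Ω * d * Real.logb 2 t ^ 2 :=
      mul_le_mul_of_nonneg_right (mul_le_mul_of_nonneg_right (hωΩ n hn) hd0) hL0
    exact h1.trans hreg
  -- mode-by-mode approximants (the zero polynomial outside the band, never used)
  have hmodec : ∀ n, ∃ P : MvPolynomial ι ℝ, P.totalDegree ≤ t ∧ (n < N → ∀ x : ι → ℝ, (∀ i, x i ∈ Set.Icc (-1 : ℝ) 1) →
      |Real.cos (ω n * ∑ i, |x i|) - MvPolynomial.eval x P| ≤ 80 * (ω n * Fintype.card ι) / t) := by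
    intro n
    by_cases hn : n < N
    · obtain ⟨P, hP, happ⟩ := exists_mvPolynomial_near_cos_l1Norm_logFree (ι := ι) ht (hω0 n) (hregn n hn)
      exact ⟨P, hP, fun _ => happ⟩
    · exact ⟨0, by simp, fun h => absurd h hn⟩
  have hmodes : ∀ n, ∃ P : MvPolynomial ι ℝ, P.totalDegree ≤ t ∧ (n < N → ∀ x : ι → ℝ, (∀ i, x i ∈ Set.Icc (-1 : ℝ) 1) →
      |Real.sin (ω n * ∑ i, |x i|) - MvPolynomial.eval x P| ≤ 80 * (ω n * Fintype.card ι) / t) := by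
    intro n
    by_cases hn : n < N
    · obtain ⟨P, hP, happ⟩ := exists_mvPolynomial_near_sin_l1Norm_logFree (ι := ι) ht (hω0 n) (hregn n hn)
      exact ⟨P, hP, fun _ => happ⟩
    · exact ⟨0, by simp, fun h => absurd h hn⟩
  choose Pc hPc_deg hPc_err using hmodec
  choose Ps hPs_deg hPs_err using hmodes
  refine ⟨MvPolynomial.C c + ∑ n ∈ range N, (MvPolynomial.C (a n) * Pc n + MvPolynomial.C (b n) * Ps n), ?_, ?_⟩
  · refine (MvPolynomial.totalDegree_add _ _).trans (max_le ?_ ?_)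
    · rw [MvPolynomial.totalDegree_C]; exact Nat.zero_le _
    · refine MvPolynomial.totalDegree_finsetSum_le fun n _ => ?_
      refine (MvPolynomial.totalDegree_add _ _).trans (max_le ?_ ?_)
      · calc (MvPolynomial.C (a n) * Pc n).totalDegree ≤ (MvPolynomial.C (a n) : MvPolynomial ι ℝ).totalDegree + (Pc n).totalDegree :=
            MvPolynomial.totalDegree_mul _ _
          _ ≤ 0 + t := by rw [MvPolynomial.totalDegree_C]; exact add_le_add le_rfl (hPc_deg n)
          _ = t := zero_add _
      · calc (MvPolynomial.C (b n) * Ps n).totalDegree ≤ (MvPolynomial.C (b n) : MvPolynomial ι ℝ).totalDegree + (Ps n).totalDegree :=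
            MvPolynomial.totalDegree_mul _ _
          _ ≤ 0 + t := by rw [MvPolynomial.totalDegree_C]; exact add_le_add le_rfl (hPs_deg n)
          _ = t := zero_add _
  · intro x hx
    have hev : MvPolynomial.eval x (MvPolynomial.C c + ∑ n ∈ range N, (MvPolynomial.C (a n) * Pc n + MvPolynomial.C (b n) * Ps n)) =
        c + ∑ n ∈ range N, (a n * MvPolynomial.eval x (Pc n) + b n * MvPolynomial.eval x (Ps n)) := by
      rw [map_add, MvPolynomial.eval_C, map_sum]
      refine congrArg _ (Finset.sum_congr rfl fun n _ => ?_)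
      rw [map_add, map_mul, map_mul, MvPolynomial.eval_C, MvPolynomial.eval_C]
    rw [hev, add_sub_add_left_eq_sub, ← Finset.sum_sub_distrib]
    refine (abs_sum_le_sum_abs _ _).trans (Finset.sum_le_sum fun n hn => ?_)
    have hn' : n < N := mem_range.1 hn
    have e : a n * Real.cos (ω n * ∑ i, |x i|) + b n * Real.sin (ω n * ∑ i, |x i|) -
        (a n * MvPolynomial.eval x (Pc n) + b n * MvPolynomial.eval x (Ps n)) =
        a n * (Real.cos (ω n * ∑ i, |x i|) - MvPolynomial.eval x (Pc n)) +
          b n * (Real.sin (ω n * ∑ i, |x i|) - MvPolynomial.eval x (Ps n)) := by ring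
    rw [e]
    calc |a n * (Real.cos (ω n * ∑ i, |x i|) - MvPolynomial.eval x (Pc n)) +
          b n * (Real.sin (ω n * ∑ i, |x i|) - MvPolynomial.eval x (Ps n))|
        ≤ |a n * (Real.cos (ω n * ∑ i, |x i|) - MvPolynomial.eval x (Pc n))| +
          |b n * (Real.sin (ω n * ∑ i, |x i|) - MvPolynomial.eval x (Ps n))| := abs_add_le _ _
      _ ≤ |a n| * (80 * (ω n * Fintype.card ι) / t) + |b n| * (80 * (ω n * Fintype.card ι) / t) := by
          rw [abs_mul, abs_mul]
          exact add_le_add (mul_le_mul_of_nonneg_left (hPc_err n hn' x hx) (abs_nonneg _))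
            (mul_le_mul_of_nonneg_left (hPs_err n hn' x hx) (abs_nonneg _))
      _ = (|a n| + |b n|) * (80 * (ω n * Fintype.card ι) / t) := by ring

/-- ★ **LINKS WITH A BAND-LIMITED TRIGONOMETRIC APPROXIMATION, LOG-FREE.**  If `|h(s) − (c + Σ_{n<N}(a_n cos(ω_ns) + b_n sin(ω_ns)))| ≤ τ` for
`s ∈ [0, d]` (`0 ≤ ω_n ≤ Ω` for `n < N`, `Ωd·(log₂t)² ≤ t∕2048`, `t ≥ 512`), then there is `P : MvPolynomial ι ℝ` of total degree `≤ t` with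
`|h(Σ_i|x_i|) − P(x)| ≤ τ + Σ_{n<N}(|a_n| + |b_n|)·80ω_n d∕t` on `[−1,1]^ι`.  READING: a link whose DERIVATIVE has an absolutely summable Fourier series
with BOUNDED spectrum costs `80·W′·d∕t`, `W′ = Σ_n(|a_n| + |b_n|)ω_n` — the ridge rate, no logarithm. [folklore] -/
theorem exists_mvPolynomial_near_link_of_trigApprox_logFree {h : ℝ → ℝ} (c : ℝ) (a b ω : ℕ → ℝ) (N : ℕ) {Ω τ : ℝ}
    (hω0 : ∀ n, 0 ≤ ω n) (hωΩ : ∀ n, n < N → ω n ≤ Ω)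
    (happrox : ∀ s : ℝ, 0 ≤ s → s ≤ Fintype.card ι →
      |h s - (c + ∑ n ∈ range N, (a n * Real.cos (ω n * s) + b n * Real.sin (ω n * s)))| ≤ τ)
    {t : ℕ} (ht : 512 ≤ t) (hreg : Ω * Fintype.card ι * Real.logb 2 t ^ 2 ≤ t / 2048) :
    ∃ P : MvPolynomial ι ℝ, P.totalDegree ≤ t ∧
      ∀ x : ι → ℝ, (∀ i, x i ∈ Set.Icc (-1 : ℝ) 1) →
        |h (∑ i, |x i|) - MvPolynomial.eval x P| ≤ τ + ∑ n ∈ range N, (|a n| + |b n|) * (80 * (ω n * Fintype.card ι) / t) := by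
  obtain ⟨P, hdeg, herr⟩ := exists_mvPolynomial_near_trigSum_l1Norm_logFree (ι := ι) c a b ω N hω0 hωΩ ht hreg
  refine ⟨P, hdeg, fun x hx => ?_⟩
  have hS := l1Norm_mem_Icc x hx
  exact (abs_sub_le _ _ _).trans (add_le_add (happrox _ hS.1 hS.2) (herr x hx))

/-! ## §2 ★ The law-level face [folklore] -/

/-- ★ **LAWS AGREEING ON `Π_t` INTEGRATE A BAND-LIMITED LINK TO WITHIN `2(τ + Σ_n(|a_n| + |b_n|)·80ω_n d∕t)`.**  Let `P, Q` be probability laws on `ℝ^ι`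
carried by `[−1,1]^ι` with equal mixed moments of total degree `≤ t` (`t ≥ 512`), `h` continuous with a band-limited trigonometric approximation as in
§1 (`Ωd·(log₂t)² ≤ t∕2048`).  Then `|∫h(Σ_i|x_i|)dP − ∫h(Σ_i|x_i|)dQ| ≤ 2(τ + Σ_{n<N}(|a_n| + |b_n|)·80ω_n d∕t)` (module 125's transfer). [folklore] -/
theorem abs_integral_trigLink_l1Norm_sub_le_logFree {P Q : Measure (ι → ℝ)} [IsProbabilityMeasure P] [IsProbabilityMeasure Q]
    (hP : P (Set.pi Set.univ (fun _ : ι => Set.Icc (-1 : ℝ) 1))ᶜ = 0) (hQ : Q (Set.pi Set.univ (fun _ : ι => Set.Icc (-1 : ℝ) 1))ᶜ = 0)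
    {t : ℕ} (ht : 512 ≤ t) (hmom : ∀ j : ι → ℕ, ∑ i, j i ≤ t → ∫ x, ∏ i, x i ^ j i ∂P = ∫ x, ∏ i, x i ^ j i ∂Q)
    {h : ℝ → ℝ} (hh : Continuous h) (c : ℝ) (a b ω : ℕ → ℝ) (N : ℕ) {Ω τ : ℝ}
    (hω0 : ∀ n, 0 ≤ ω n) (hωΩ : ∀ n, n < N → ω n ≤ Ω)
    (happrox : ∀ s : ℝ, 0 ≤ s → s ≤ Fintype.card ι →
      |h s - (c + ∑ n ∈ range N, (a n * Real.cos (ω n * s) + b n * Real.sin (ω n * s)))| ≤ τ)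
    (hreg : Ω * Fintype.card ι * Real.logb 2 t ^ 2 ≤ t / 2048) :
    |∫ x, h (∑ i, |x i|) ∂P - ∫ x, h (∑ i, |x i|) ∂Q| ≤ 2 * (τ + ∑ n ∈ range N, (|a n| + |b n|) * (80 * (ω n * Fintype.card ι) / t)) := by
  obtain ⟨F, hF, happ⟩ := exists_mvPolynomial_near_link_of_trigApprox_logFree (ι := ι) c a b ω N hω0 hωΩ happrox ht hreg
  have hg : Continuous fun x : ι → ℝ => h (∑ i, |x i|) := hh.comp continuous_l1Norm
  exact abs_integral_sub_integral_le_of_near hP hQ hmom hg hF happ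

end Summit.QuantumFields.YangMills.Theorems.BalabanUVNodesN19OscillatingLinksLogFree

end
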